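import Summits.BirchSwinnertonDyer.Rank1Residual.Additive.XGordRankZeroOneCyclotomicThreeFacts
import Summits.BirchSwinnertonDyer.Rank1Residual.Additive.XGordRankZeroOneCyclotomicThreeNoLocal
import HarnessLib

/-!
# Line V17 at Facts level (X3 via Wuthrich Thm. 16, X4 via Kato Thm. 17.4 (3); `p = 3`, `K = ℚ(ζ₃)`,
# ranks `(0,1)`, UPPER half and the doubly-unit `BSD₃` ENDs) with Milne's A73 PROVED AWAY
# (cell `b2b-bsdres`, team n1011, seat p16 GEN 11; lead R5-87 (e) (W2) = additive-p4 GEN 23 word; row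
# T-MIL-CAN; Facts-level consumer of `XGordRankZeroOneCyclotomicThreeNoLocal`)

HONEST FRAMING (cell `b2b-bsdres`, run/shared/lean/b2b/bsd-rank1-residual/, verbatim in every
file): the goal of the cell is to DELETE the COMBINATION-SHAPED residual classes of the
Birch–Swinnerton-Dyer formula for ALL analytic-rank `≤ 1` elliptic curves over `ℚ` — "full BSD
formula for every rank `≤ 1` curve in class `C`" assembled STRICTLY from published theorems — so
that the rank-`≤ 1` remainder becomes exactly the CONSTRUCTION-SHAPED classes, which are TYPED
(missing-input `Prop`s), NOT attempted. This is not "finishing BSD". Team n1011 (N10 / N11), seat p16: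
research route; X1 / X3 / X4 / X10 / N10 / N11 labels and marks UNCHANGED; nothing booked. Theorems only.

This is additive-p4's `XGordRankZeroOneCyclotomicThreeFacts.lean` §2–§3 (line V17 from named facts:
`X3GordRankZeroOneCyclotomicThree.exists_padicVal_shaOrder_add_le_of_facts`,
`X4GordRankZeroOneCyclotomicThree.exists_padicVal_shaOrder_add_le_of_surj_of_ram`, and the four §3 ENDs
`…bsdp_of_shaAn_units…`, `…missingUpperBoundAt…`) with the Milne binder
`hMilne : Milne1972.bsdQuotient_baseChange_quadratic_anyModel` (A73) DELETED and nothing added — every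
theorem re-issued under the same name with the suffix `_noMilne`, every other binder and every proof line
byte-identical, the core call going to the p16 twin
`XGordRankZeroOneCyclotomicThree.exists_padicVal_shaOrder_add_le_noLocal` (`Ш(V_K)` finite from
`shaFinite_baseChange_of_twist`; the any-rank `3`-adic card identity from T-MIL-CAN FILE 4
`padicVal_card_identity_baseChange_anyRank_of_natAbs_discr_eq` — `|d_K| = 3`, `V` good at `3`, the per-place
fibre identities (T) at EVERY place by n1011-p01's T-MIL-3 H-5a with rows T-MIL-B2 / T-A233 inside); §1
(`XGordRankZeroOneCyclotomicThree.schneiderK_of_fact`) is used as landed. Remaining named facts of line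
V17: Wuthrich Thm. 16 (`hW16`, X3) resp. Kato Thm. 17.4 (3) (`hKato`, X4) over `K`, Greenberg p. 110 /
Schneider (`hS1`), Perrin-Riou (`hPR`), Mazur–Tate σ (`hMT`), modularity (`hmod`, `hmodD`), GZK (`hGZK`);
per row the certificate `hcert` and the unit bits. Labels UNCHANGED; nothing booked; no mark moves.
-/

noncomputable section

open scoped Classical MatrixGroups ModularForm

open CongruenceSubgroup WeierstrassCurve NumberField IsDedekindDomain
  Literature.NumberTheory.EllipticCurves Literature.NumberTheory.EllipticCurves.ModularForms
  Literature.NumberTheory.EllipticCurves.Rank1Residual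
  Literature.NumberTheory.EllipticCurves.Rank1Residual.Typed
  Literature.NumberTheory.GaloisRepresentations

namespace Summit.BirchSwinnertonDyer.Rank1Residual.Additive

section Facts

variable (V : WeierstrassCurve ℚ) [V.IsElliptic] [V.IsGloballyMinimal]
  (W : WeierstrassCurve ℚ) [W.IsElliptic] [W.IsGloballyMinimal]

/-- **Line V17 for X3, FROM NAMED FACTS ONLY, NO Milne.** Let `V/ℚ` be globally minimal, good ordinary at `3`
with `V[3]` REDUCIBLE, of analytic rank `1`, and `W = C • V^{(−3)}` globally minimal ADDITIVE at `3`
(the X3 ∧ (G-ord, `e = 2`) situation) of analytic rank `0`; assume the certificate `[T¹]L₃(f,α) ≠ 0` for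
the newform(s) of `V` (`hcert`). Then `#Ш_an(V) = q_V`, `#Ш_an(W) = q_W` are rationals with
**`ord₃ #Ш(V) + ord₃ #Ш(W) ≤ ord₃ q_V + ord₃ q_W`**, granted EXACTLY: Wuthrich 2014 Thm. 16 over `ℚ(ζ₃)`
(`hW16`), Greenberg p. 110 / Schneider 1985 over `ℚ(ζ₃)` (`hS1`), Perrin-Riou 1987 (`hPR`), the
Mazur–Tate sigma function at odd `p` (`hMT`, existence of THE canonical `3`-adic height), modularity
(`hmod`, `hmodD`), Gross–Zagier–Kolyvagin (`hGZK`) — and NO Milne: the core is the p16 twin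
`XGordRankZeroOneCyclotomicThree.exists_padicVal_shaOrder_add_le_noLocal` (`Ш(V_K)` finite and the any-rank
`3`-adic card identity are THEOREMS, T-MIL-CAN FILE 4). Binder diff vs additive-p4's `…_of_facts`: {`hMilne`} ↦ ∅.
[cite: Wuthrich2014, Thm. 16 (p. 397)] [cite: GreenbergLNM1716, §4 p. 110] [cite: PerrinRiou1987, §1.4 Cor. 1.8]
[cite: Milne1972ArithmeticAV, §1 Thm. 1 and §2 (through DokchitserDokchitserAnnals2010, §2.1, proof of Thm. 8)] -/
theorem X3GordRankZeroOneCyclotomicThree.exists_padicVal_shaOrder_add_le_of_facts_noMilne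
    (hW16 : Wuthrich2014.charIdeal_dvd_padicLFunction_cyclotomicThree)
    (hS1 : Greenberg1999.schneider_charCoeff_rankOne_quadraticBaseChange)
    (hPR : perrinRiou_rankOne_leadingTerms_odd) (hMT : mazur_tate_sigma_exists_odd)
    (hGZK : rank_eq_analyticRank_of_analyticRank_le_one) (hmod : hasEntireLFunction_rat)
    (hmodD : nonempty_modularParametrizationData)
    (C : VariableChange ℚ) (hC : C • V.quadraticTwist (-(3 : ℚ)) = W)
    (hord : IsOrdinaryAt V 3) (hred : ¬ V.HasIrreducibleModPGaloisRep 3) (hadd : Addv W 3)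
    (hrV : V.analyticRank = 1) (hrW : W.analyticRank = 0)
    (hcert : ∀ {N : ℕ} [NeZero N] (f : CuspForm (Gamma0 N) 2), IsNewformOf V f →
      PowerSeries.coeff 1 (padicLFunction f ((unitRoot V 3 : ℤ_[3]) : ℚ_[3])) ≠ 0) :
    ∃ qV qW : ℚ, shaAn V = (qV : ℂ) ∧ shaAn W = (qW : ℂ) ∧
      (padicValNat 3 V.shaOrder : ℤ) + padicValNat 3 W.shaOrder ≤ padicValRat 3 qV + padicValRat 3 qW := by
  haveI : IsCyclotomicExtension {3} ℚ (CyclotomicField 3 ℚ) := CyclotomicField.isCyclotomicExtension 3 ℚ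
  set K := CyclotomicField 3 ℚ
  haveI : NeZero (V.conductorNorm ℤ) := ⟨(V.conductorNorm_pos_holds).ne'⟩
  obtain ⟨Dm⟩ := hmodD V
  have hf : IsNewformOf V Dm.f := Dm.isNewformOf
  obtain ⟨ϖ, -, hϖ, -⟩ := Dm.exists_rat_mul_realPeriodRat_eq_plusPeriod
  obtain ⟨ϖ', -, hϖ'⟩ := exists_rat_mul_imaginaryPeriodRat_eq_minusPeriod Dm
  obtain ⟨Dh, hDh⟩ := exists_isCanonical_of_odd hMT V 3 (by norm_num) hord.1 hord.2
  refine XGordRankZeroOneCyclotomicThree.exists_padicVal_shaOrder_add_le_noLocal K V W hPR hGZK hmod C hC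
    hord hadd hrV hrW hf ϖ ϖ' hϖ hϖ' Dh hDh (hcert Dm.f hf) (fun κ γ hκ hγ hγ' D ↦ ?_)
    (XGordRankZeroOneCyclotomicThree.schneiderK_of_fact K V hS1 hord)
  exact hW16 V K (V.baseChange K) hord hred ⟨1, one_smul _ _⟩ hκ hγ hγ' hf D ϖ ϖ' hϖ hϖ'

/-- **Line V17 for X4, FROM NAMED FACTS ONLY, NO Milne.** As `X3GordRankZeroOneCyclotomicThree…_of_facts_noMilne`, with
`ρ_{V,3^∞}` onto in place of reducibility — supplied by the census bits `surj(3) ∧ ram(3)` of `W`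
(`forall_surj_pow_of_twist_pStar_of_surj_of_ram`) — and Kato Astérisque 295 Thm. 17.4 (3) over `ℚ(ζ₃)`
(`hKato`) in place of Wuthrich Thm. 16; NO Milne.
[cite: Kato2004Asterisque, Thm. 17.4 (3) (p. 273)] [cite: GreenbergLNM1716, §4 p. 110]
[cite: PerrinRiou1987, §1.4 Cor. 1.8] [cite: Milne1972ArithmeticAV, §1 Thm. 1 and §2 (through DokchitserDokchitserAnnals2010, §2.1, proof of Thm. 8)] -/
theorem X4GordRankZeroOneCyclotomicThree.exists_padicVal_shaOrder_add_le_of_surj_of_ram_noMilne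
    (hKato : Kato2004.charIdeal_dvd_padicLFunction_cyclotomicThree_of_surjective)
    (hS1 : Greenberg1999.schneider_charCoeff_rankOne_quadraticBaseChange)
    (hPR : perrinRiou_rankOne_leadingTerms_odd) (hMT : mazur_tate_sigma_exists_odd)
    (hGZK : rank_eq_analyticRank_of_analyticRank_le_one) (hmod : hasEntireLFunction_rat)
    (hmodD : nonempty_modularParametrizationData)
    (C : VariableChange ℚ) (hC : C • V.quadraticTwist (-(3 : ℚ)) = W)
    (hord : IsOrdinaryAt V 3) (hsurj : Surj W 3) (hram : Ram W 3) (hadd : Addv W 3)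
    (hrV : V.analyticRank = 1) (hrW : W.analyticRank = 0)
    (hcert : ∀ {N : ℕ} [NeZero N] (f : CuspForm (Gamma0 N) 2), IsNewformOf V f →
      PowerSeries.coeff 1 (padicLFunction f ((unitRoot V 3 : ℤ_[3]) : ℚ_[3])) ≠ 0) :
    ∃ qV qW : ℚ, shaAn V = (qV : ℂ) ∧ shaAn W = (qW : ℂ) ∧
      (padicValNat 3 V.shaOrder : ℤ) + padicValNat 3 W.shaOrder ≤ padicValRat 3 qV + padicValRat 3 qW := by
  haveI : IsCyclotomicExtension {3} ℚ (CyclotomicField 3 ℚ) := CyclotomicField.isCyclotomicExtension 3 ℚ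
  set K := CyclotomicField 3 ℚ
  haveI : NeZero (V.conductorNorm ℤ) := ⟨(V.conductorNorm_pos_holds).ne'⟩
  obtain ⟨Dm⟩ := hmodD V
  have hf : IsNewformOf V Dm.f := Dm.isNewformOf
  obtain ⟨ϖ, -, hϖ, -⟩ := Dm.exists_rat_mul_realPeriodRat_eq_plusPeriod
  obtain ⟨ϖ', -, hϖ'⟩ := exists_rat_mul_imaginaryPeriodRat_eq_minusPeriod Dm
  obtain ⟨Dh, hDh⟩ := exists_isCanonical_of_odd hMT V 3 (by norm_num) hord.1 hord.2
  have hC' : C • V.quadraticTwist (((-((3 : ℕ) : ℤ)) : ℤ) : ℚ) = W := by push_cast; exact hC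
  have hsurjV : ∀ n : ℕ, V.HasSurjectiveModNGaloisRep (3 ^ n : ℕ) :=
    forall_surj_pow_of_twist_pStar_of_surj_of_ram 3 V (k := -1) (by norm_num) (Or.inr rfl) C hC' hsurj hram
  refine XGordRankZeroOneCyclotomicThree.exists_padicVal_shaOrder_add_le_noLocal K V W hPR hGZK hmod C hC
    hord hadd hrV hrW hf ϖ ϖ' hϖ hϖ' Dh hDh (hcert Dm.f hf) (fun κ γ hκ hγ hγ' D ↦ ?_)
    (XGordRankZeroOneCyclotomicThree.schneiderK_of_fact K V hS1 hord)
  exact hKato V K (V.baseChange K) hord hsurjV ⟨1, one_smul _ _⟩ hκ hγ hγ' hf D ϖ ϖ' hϖ hϖ'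

/-! ## §3 The typed upper half for `W` and `BSD₃` on both curves on the doubly-unit rows (NO Milne) -/

/-- **X3, ranks `(0,1)`: `BSD(W,3) ∧ BSD(V,3)` on the doubly-unit rows, from named facts + the
certificate, NO Milne.** If moreover `#Ш_an(V)` and `#Ш_an(W)` are `3`-adic units then Miller's `BSD(W,3)` (the
additive X3 pair of analytic rank `0`) and `BSD(V,3)` (its good ordinary Eisenstein twist pair of
analytic rank ONE — an X1 `r = 1` pair) hold. Census: 73 of the 74 CORE-open X3 rows. Labels UNCHANGED;
nothing booked. [cite: Wuthrich2014, Thm. 16 (p. 397)] [cite: GreenbergLNM1716, §4 p. 110]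
[cite: PerrinRiou1987, §1.4 Cor. 1.8] [cite: Miller2011LMS, §1 and Def. 1.1] -/
theorem X3GordRankZeroOneCyclotomicThree.bsdp_of_shaAn_units_of_facts_noMilne
    (hW16 : Wuthrich2014.charIdeal_dvd_padicLFunction_cyclotomicThree)
    (hS1 : Greenberg1999.schneider_charCoeff_rankOne_quadraticBaseChange)
    (hPR : perrinRiou_rankOne_leadingTerms_odd) (hMT : mazur_tate_sigma_exists_odd)
    (hGZK : rank_eq_analyticRank_of_analyticRank_le_one) (hmod : hasEntireLFunction_rat)
    (hmodD : nonempty_modularParametrizationData)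
    (C : VariableChange ℚ) (hC : C • V.quadraticTwist (-(3 : ℚ)) = W)
    (hord : IsOrdinaryAt V 3) (hred : ¬ V.HasIrreducibleModPGaloisRep 3) (hadd : Addv W 3)
    (hrV : V.analyticRank = 1) (hrW : W.analyticRank = 0)
    (hcert : ∀ {N : ℕ} [NeZero N] (f : CuspForm (Gamma0 N) 2), IsNewformOf V f →
      PowerSeries.coeff 1 (padicLFunction f ((unitRoot V 3 : ℤ_[3]) : ℚ_[3])) ≠ 0)
    {qV qW : ℚ} (hqV : shaAn V = (qV : ℂ)) (hqW : shaAn W = (qW : ℂ))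
    (hvV : padicValRat 3 qV = 0) (hvW : padicValRat 3 qW = 0) : BSDp W 3 ∧ BSDp V 3 := by
  obtain ⟨qV', qW', hqV', hqW', hle⟩ :=
    X3GordRankZeroOneCyclotomicThree.exists_padicVal_shaOrder_add_le_of_facts_noMilne V W hW16 hS1 hPR hMT
      hGZK hmod hmodD C hC hord hred hadd hrV hrW hcert
  have hqq : qV' = qV := by exact_mod_cast hqV'.symm.trans hqV
  have hqq' : qW' = qW := by exact_mod_cast hqW'.symm.trans hqW
  subst hqq hqq'
  rw [hvV, hvW, add_zero] at hle
  have hV0 : (0 : ℤ) ≤ padicValNat 3 V.shaOrder := by positivity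
  have hW0 : (0 : ℤ) ≤ padicValNat 3 W.shaOrder := by positivity
  have huW : MissingUpperBoundAt W 3 := ⟨qW', hqW', by rw [hvW]; linarith⟩
  have huV : MissingUpperBoundAt V 3 := ⟨qV', hqV', by rw [hvV]; linarith⟩
  exact ⟨bsdp_of_missingPPartAt W 3 hGZK (by rw [hrW]; exact zero_le_one)
      (missingPPartAt_of_upper_of_shaAn_unit W 3 huW hqW' hvW),
    bsdp_of_missingPPartAt V 3 hGZK (by rw [hrV])
      (missingPPartAt_of_upper_of_shaAn_unit V 3 huV hqV' hvV)⟩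

/-- **X3, ranks `(0,1)`: the cell's typed UPPER half for the additive curve, NO Milne** — if `#Ш_an(V)` has
non-positive `3`-adic valuation (census: `3 ∤ #Ш_an(V)` on every row) then `Typed.MissingUpperBoundAt W 3`;
with a `3`-descent certificate and Cassels–Tate this closes the `3 ∣ #Ш_an(W)` row (819e1-type) too.
[cite: Wuthrich2014, Thm. 16 (p. 397)] [cite: GreenbergLNM1716, §4 p. 110] -/
theorem X3GordRankZeroOneCyclotomicThree.missingUpperBoundAt_of_facts_noMilne
    (hW16 : Wuthrich2014.charIdeal_dvd_padicLFunction_cyclotomicThree)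
    (hS1 : Greenberg1999.schneider_charCoeff_rankOne_quadraticBaseChange)
    (hPR : perrinRiou_rankOne_leadingTerms_odd) (hMT : mazur_tate_sigma_exists_odd)
    (hGZK : rank_eq_analyticRank_of_analyticRank_le_one) (hmod : hasEntireLFunction_rat)
    (hmodD : nonempty_modularParametrizationData)
    (C : VariableChange ℚ) (hC : C • V.quadraticTwist (-(3 : ℚ)) = W)
    (hord : IsOrdinaryAt V 3) (hred : ¬ V.HasIrreducibleModPGaloisRep 3) (hadd : Addv W 3)
    (hrV : V.analyticRank = 1) (hrW : W.analyticRank = 0)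
    (hcert : ∀ {N : ℕ} [NeZero N] (f : CuspForm (Gamma0 N) 2), IsNewformOf V f →
      PowerSeries.coeff 1 (padicLFunction f ((unitRoot V 3 : ℤ_[3]) : ℚ_[3])) ≠ 0)
    {qV : ℚ} (hqV : shaAn V = (qV : ℂ)) (hv : padicValRat 3 qV ≤ 0) :
    MissingUpperBoundAt W 3 := by
  obtain ⟨qV', qW, hqV', hqW, hle⟩ :=
    X3GordRankZeroOneCyclotomicThree.exists_padicVal_shaOrder_add_le_of_facts_noMilne V W hW16 hS1 hPR hMT
      hGZK hmod hmodD C hC hord hred hadd hrV hrW hcert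
  have hqq : qV' = qV := by exact_mod_cast hqV'.symm.trans hqV
  subst hqq
  refine ⟨qW, hqW, ?_⟩
  have h0 : (0 : ℤ) ≤ padicValNat 3 V.shaOrder := by positivity
  linarith

/-- **X4, ranks `(0,1)`: `BSD(W,3) ∧ BSD(V,3)` on the doubly-unit rows with `surj(3) ∧ ram(3)`, from
named facts + the certificate, NO Milne.** Census: 68 of the 75 CORE-open X4 rows (2 more have `3 ∣ #Ш_an(W)`,
5 lack a `ram` prime). `(V,3)` is an irreducible good ordinary rank-ONE pair at `p = 3` (X10-type).
Labels UNCHANGED; nothing booked. [cite: Kato2004Asterisque, Thm. 17.4 (3) (p. 273)]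
[cite: GreenbergLNM1716, §4 p. 110] [cite: PerrinRiou1987, §1.4 Cor. 1.8] [cite: Miller2011LMS, §1 and Def. 1.1] -/
theorem X4GordRankZeroOneCyclotomicThree.bsdp_of_shaAn_units_of_surj_of_ram_noMilne
    (hKato : Kato2004.charIdeal_dvd_padicLFunction_cyclotomicThree_of_surjective)
    (hS1 : Greenberg1999.schneider_charCoeff_rankOne_quadraticBaseChange)
    (hPR : perrinRiou_rankOne_leadingTerms_odd) (hMT : mazur_tate_sigma_exists_odd)
    (hGZK : rank_eq_analyticRank_of_analyticRank_le_one) (hmod : hasEntireLFunction_rat)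
    (hmodD : nonempty_modularParametrizationData)
    (C : VariableChange ℚ) (hC : C • V.quadraticTwist (-(3 : ℚ)) = W)
    (hord : IsOrdinaryAt V 3) (hsurj : Surj W 3) (hram : Ram W 3) (hadd : Addv W 3)
    (hrV : V.analyticRank = 1) (hrW : W.analyticRank = 0)
    (hcert : ∀ {N : ℕ} [NeZero N] (f : CuspForm (Gamma0 N) 2), IsNewformOf V f →
      PowerSeries.coeff 1 (padicLFunction f ((unitRoot V 3 : ℤ_[3]) : ℚ_[3])) ≠ 0)
    {qV qW : ℚ} (hqV : shaAn V = (qV : ℂ)) (hqW : shaAn W = (qW : ℂ))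
    (hvV : padicValRat 3 qV = 0) (hvW : padicValRat 3 qW = 0) : BSDp W 3 ∧ BSDp V 3 := by
  obtain ⟨qV', qW', hqV', hqW', hle⟩ :=
    X4GordRankZeroOneCyclotomicThree.exists_padicVal_shaOrder_add_le_of_surj_of_ram_noMilne V W hKato hS1 hPR hMT
      hGZK hmod hmodD C hC hord hsurj hram hadd hrV hrW hcert
  have hqq : qV' = qV := by exact_mod_cast hqV'.symm.trans hqV
  have hqq' : qW' = qW := by exact_mod_cast hqW'.symm.trans hqW
  subst hqq hqq'
  rw [hvV, hvW, add_zero] at hle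
  have hV0 : (0 : ℤ) ≤ padicValNat 3 V.shaOrder := by positivity
  have hW0 : (0 : ℤ) ≤ padicValNat 3 W.shaOrder := by positivity
  have huW : MissingUpperBoundAt W 3 := ⟨qW', hqW', by rw [hvW]; linarith⟩
  have huV : MissingUpperBoundAt V 3 := ⟨qV', hqV', by rw [hvV]; linarith⟩
  exact ⟨bsdp_of_missingPPartAt W 3 hGZK (by rw [hrW]; exact zero_le_one)
      (missingPPartAt_of_upper_of_shaAn_unit W 3 huW hqW' hvW),
    bsdp_of_missingPPartAt V 3 hGZK (by rw [hrV])
      (missingPPartAt_of_upper_of_shaAn_unit V 3 huV hqV' hvV)⟩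

/-- **X4, ranks `(0,1)`: the cell's typed UPPER half for the additive curve, NO Milne** (`surj(3) ∧ ram(3)`),
under `ord₃ #Ш_an(V) ≤ 0`. [cite: Kato2004Asterisque, Thm. 17.4 (3) (p. 273)] [cite: GreenbergLNM1716, §4 p. 110] -/
theorem X4GordRankZeroOneCyclotomicThree.missingUpperBoundAt_of_surj_of_ram_noMilne
    (hKato : Kato2004.charIdeal_dvd_padicLFunction_cyclotomicThree_of_surjective)
    (hS1 : Greenberg1999.schneider_charCoeff_rankOne_quadraticBaseChange)
    (hPR : perrinRiou_rankOne_leadingTerms_odd) (hMT : mazur_tate_sigma_exists_odd)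
    (hGZK : rank_eq_analyticRank_of_analyticRank_le_one) (hmod : hasEntireLFunction_rat)
    (hmodD : nonempty_modularParametrizationData)
    (C : VariableChange ℚ) (hC : C • V.quadraticTwist (-(3 : ℚ)) = W)
    (hord : IsOrdinaryAt V 3) (hsurj : Surj W 3) (hram : Ram W 3) (hadd : Addv W 3)
    (hrV : V.analyticRank = 1) (hrW : W.analyticRank = 0)
    (hcert : ∀ {N : ℕ} [NeZero N] (f : CuspForm (Gamma0 N) 2), IsNewformOf V f →
      PowerSeries.coeff 1 (padicLFunction f ((unitRoot V 3 : ℤ_[3]) : ℚ_[3])) ≠ 0)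
    {qV : ℚ} (hqV : shaAn V = (qV : ℂ)) (hv : padicValRat 3 qV ≤ 0) :
    MissingUpperBoundAt W 3 := by
  obtain ⟨qV', qW, hqV', hqW, hle⟩ :=
    X4GordRankZeroOneCyclotomicThree.exists_padicVal_shaOrder_add_le_of_surj_of_ram_noMilne V W hKato hS1 hPR hMT
      hGZK hmod hmodD C hC hord hsurj hram hadd hrV hrW hcert
  have hqq : qV' = qV := by exact_mod_cast hqV'.symm.trans hqV
  subst hqq
  refine ⟨qW, hqW, ?_⟩
  have h0 : (0 : ℤ) ≤ padicValNat 3 V.shaOrder := by positivity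
  linarith

end Facts

end Summit.BirchSwinnertonDyer.Rank1Residual.Additive

end
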